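import Literature.IUT.HodgeTheaters.GenuineFKitOfBadLocalRealifiedNotRigid
import Literature.IUT.HodgeTheaters.HodgeTheaterModelFKitCor56iLaws
import HarnessLib

/-!
# [IUTchI] Cor. 5.6 (i) READ AT THE GENUINE `ℱ`-KIT `genuineFKitOfBadLocal … I` (L5 ROWS R61 «COR56I-AT-GENUINE-KIT»):
# every conjunct of abc-iut-w5-d217's kit pattern decided in the kernel — the reading IS the rigidity of the (m4) slot

S. Mochizuki, *Inter-universal Teichmüller theory I: construction of Hodge theaters*, kurims manuscript (May 2020), §5,
Corollary 5.6 (i), statement p. 153 l. 67–70, proof p. 154 l. 8–24; Remark 5.2.1 (ii) p. 143 l. 19–34 («the rigidity of the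
divisor monoids»); Definition 3.6 (c) p. 87; Definition 5.2 (iv) pp. 134–135; Example 3.5 (i)(ii) pp. 84–86
([IUTchI] Cor 5.6 (i) p.153) [claim: Mochizuki2012, status: disputed] (D-0012 claim key, series status DISPUTED — nothing of the
series is asserted here; no side is taken on [IUTchIII] Cor. 3.12).
S. Mochizuki, *The geometry of Frobenioids I*, Kyushu J. Math. **62** (2008), Prop. 2.5 (iii) p. 49, Thm. 6.4 (i) p. 114
[cite: MochizukiFrdI2008, Thm. 6.4 (i) p.114] (the two facts about THE `𝒞⊩_mod` consumed by name below).

PROOF-ONLY file (abc-iut cell, L5 [IUTchI], seat abc-iut-L5-t13 gen 10; row R61 of abc-iut-L5-lead RULINGS #123 (4); 0 `def`,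
0 `instance`, 0 notation, nothing restated).  INPUTS BY NAME: abc-iut-L5-t2's TERM `InitialThetaData.genuineFKitOfBadLocal`
(★ p496697, the L5 base-merge of record) and its (m4) re-instantiations `MergeInputs.withM4` / `MergeInputs.overPhi` /
`RealifiedGlobalSide.ofNumberFieldOverPhi` (★ p500041) / `RealifiedGlobalSide.ofNumberField` (★ p497530); abc-iut-w5-d217's
kit pattern `Cor56iKit`, `RlfIsoFaithful`, `RlfIsoLifts`, `RlfDetermined`, `ThToFBijOnGood` (`ThetaHodgeTheatersCor56iSub`),
`RlfOfNatural`, `ThetaHT.IsCanonical`, `Cor56iKitCanonical` (`HodgeTheaterModelFKitCor56iLaws`) and its component criteria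
(`HodgeTheaterModelFKitCor56i`); abc-iut-L5-t4's `IsomFtoDBijective` / `AutTemperedBijective` / `RlfOfIsStrip` (`FPrimeStrips`);
abc-iut-L5-t2's `subsingleton_end_gModel_ofNumberFieldOverPhi` (★ p500041, source abc-iut-L1-t3 ★ p496532) and
`not_subsingleton_end_gModel_ofNumberField` (★ p500732 `GenuineFKitOfBadLocalRealifiedNotRigid`, source abc-iut-L1-t3 ★ p499823
`arithRlf_exists_equivalence_not_iso_id`).

WHAT IS DECIDED, for EVERY merge record `I` (§1–§2) — the kit's realified ambient is `I.m4.Glob × ∏_x 𝒟_x-isomorphs` with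
`‡𝔉^⊩ ↦ ‡𝔉^⊢` the SECOND projection and `‡𝔉 ↦ ‡𝔉^⊩ = (model, ‡𝔉)`:
* HOLD unconditionally: L02 `ThToFBijOnGood` (`ℱ̲_v ↦ ℱ_v` is `𝟭`); Cor 5.3 (ii) `IsomFtoDBijective` and Cor 5.3 (iv)
  `AutTemperedBijective` AS TYPED (`𝔉 ↦ 𝔇` is the fully faithful inclusion of codes — the σ3 LABEL of the term: «isomorphisms of
  collections of data READ AS isomorphisms of their bases», a recorded tautology, NOT evidence for print); functoriality
  `RlfOfNatural`; Rmk 5.2.1 (ii) `RlfOfIsStrip`; (ε) `IsCanonical` for EVERY typed Θ-Hodge theater; row L03b `RlfIsoLifts`.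
* THE ONE NON-TRIVIAL CONJUNCT: row L03a `RlfIsoFaithful` («rigidity of the divisor monoids») ⟺ the model `I.m4.gModel` of the
  (m4) slot has only ONE automorphism in `I.m4.Glob` (`genuineFKitOfBadLocal_rlfIsoFaithful_iff`); hence
  `RlfDetermined ⟺ Cor56iKit ⟺ Cor56iKitCanonical ⟺` the same (`…_cor56iKit_iff`, `…_cor56iKitCanonical_iff`).
* INSTANCES (§3): at the slot of record `I.withM4 (RealifiedGlobalSide.ofNumberFieldOverPhi L)` / `I.overPhi` (isomorphisms OVER
  `F_{Φ^rlf}`, trivial by ★ p496532) ALL conjuncts HOLD, so `Cor56iKitCanonical` AND the all-framings `Cor56iKit` HOLD AT THE KIT;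
  at the bare slot `I.withM4 (RealifiedGlobalSide.ofNumberField L)` (`Aut(𝒞⊩_mod) ∋ [powFunctor 2] ≠ 1`, ★ p500732 / ★ p499823) `RlfIsoFaithful`,
  `RlfDetermined`, `Cor56iKit`, `Cor56iKitCanonical` are all REFUTED-AT-KIT (RULINGS #120 (1)(a) «refuted-at-bare-m4» as theorems).
HONEST LABEL: «holds-at-kit» / «refuted-at-kit» are statements about OUR binders — the σ3 term over the kit of record with its
(m4) slot — not about [IUTchI] Cor. 5.6 (i) in print; typed ≠ inhabited ≠ proved; nothing here asserts abc proved or refuted.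
-/

noncomputable section

namespace Literature.IUT.HodgeTheaters

open CategoryTheory _root_.NumberField _root_.IsDedekindDomain Literature.NumberTheory.NumberFields
  Literature.AlgebraicGeometry.Frobenioids Literature.AlgebraicGeometry.Frobenioids.PadicFrd
  Literature.AnabelianGeometry.SemiGraphs

/-! ### §0 Two folklore bridges (private plumbing) -/

/-- If every endomorphism of `X` is the identity then `X` has exactly one automorphism. [folklore] -/
private theorem subsingleton_iso_of_subsingleton_end {C : Type*} [Category C] {X : C} (h : Subsingleton (X ⟶ X)) :
    Subsingleton (X ≅ X) :=
  ⟨fun _ _ => Iso.ext (Subsingleton.elim _ _)⟩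

/-- In the one-object kind `SingleObj G` of a group `G` ([IUTchI] §0 conventions, abc-iut-L5-t4's `ConventionsCatIsomorphismGroup`),
the automorphisms of `⋆` form a subsingleton iff `G` is trivial. [folklore] -/
private theorem subsingleton_iso_singleObj_star_iff (G : Type*) [Group G] :
    Subsingleton (SingleObj.star G ≅ SingleObj.star G) ↔ Subsingleton G :=
  (Groupoid.isoEquivHom (SingleObj.star G) (SingleObj.star G)).subsingleton_congr

namespace InitialThetaData

/-- The model of the BARE (m4) slot `RealifiedGlobalSide.ofNumberField L` (★ p497530) has MORE THAN ONE automorphism in its `Glob`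
(abc-iut-L5-t2 ★ p500732 `not_subsingleton_end_gModel_ofNumberField` — `Aut(𝒞⊩_mod) ∋ [powFunctor 2] ≠ 1`, abc-iut-L1-t3 ★ p499823 — read
on isomorphisms through the one-object groupoid). [cite: MochizukiFrdI2008, Thm. 6.4 (i) p.114] -/
theorem not_subsingleton_iso_gModel_ofNumberField (L : Type) [Field L] [NumberField L] :
    letI := (RealifiedGlobalSide.ofNumberField L).cat
    ¬ Subsingleton ((RealifiedGlobalSide.ofNumberField L).gModel ≅ (RealifiedGlobalSide.ofNumberField L).gModel) := fun h =>
  not_subsingleton_end_gModel_ofNumberField L ((subsingleton_iso_singleObj_star_iff (CatAut (rlfArithCat L))).1 h)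

/-- The model of the (m4) slot OF RECORD `RealifiedGlobalSide.ofNumberFieldOverPhi L` (★ p500041) has exactly ONE automorphism in its
`Glob` (abc-iut-L1-t3 ★ p496532 via `subsingleton_end_gModel_ofNumberFieldOverPhi`). [cite: MochizukiFrdI2008, Thm. 6.4 (i) p.114] -/
theorem subsingleton_iso_gModel_ofNumberFieldOverPhi (L : Type) [Field L] [NumberField L] :
    letI := (RealifiedGlobalSide.ofNumberFieldOverPhi L).cat
    Subsingleton ((RealifiedGlobalSide.ofNumberFieldOverPhi L).gModel ≅ (RealifiedGlobalSide.ofNumberFieldOverPhi L).gModel) := by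
  letI := (RealifiedGlobalSide.ofNumberFieldOverPhi L).cat
  exact subsingleton_iso_of_subsingleton_end (subsingleton_end_gModel_ofNumberFieldOverPhi L)

variable {F K Fbar : Type} [Field F] [NumberField F] [Field K] [NumberField K] [Algebra F K]
  [Field Fbar] [Algebra F Fbar] [Algebra K Fbar] {E : WeierstrassCurve F}
  [E.IsElliptic] {l : ℕ} {Pb : BadPlacePredicates K} (D : InitialThetaData F K Fbar E l Pb)
  (CG : D.geom.pe.CuspGalois) (hS : D.CuspClassesNormaliserStable) [Fact l.Prime]
  (M : D.TorsionMonodromy) (hA : D.geom.pe.ArrowCoveringClaims)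
  (hI : ∀ k ∈ D.geom.pe.inertia D.geom.pe.ε1, M.tau (D.geom.embK k) = 0)
  (B : ∀ v, v ∈ D.indexCopyBad → D.BadPairAt v)
  (ΛBad : ∀ v (h : v ∈ D.indexCopyBad), D.LocalArrowLaw CG hS (B v h).H)
  {Gv : D.IndexCopy → Subgroup (Fbar ≃ₐ[F] Fbar)}
  (ES : ∀ v, v ∈ D.indexCopyBad → EvalSectionBinder (D.localDataOfBadPairs CG hS M hA hI B ΛBad v) (Gv v))
  (I : D.MergeInputs B)

/-! ### §1 The conjuncts that HOLD at the genuine kit for EVERY merge record `I` -/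

/-- **L02 `ThToFBijOnGood` HOLDS at the genuine kit** (for every `I`): `ℱ̲_v ↦ ℱ_v` is the identity functor on codes.
([IUTchI] Cor 5.6 (i) p.154) [claim: Mochizuki2012, status: disputed] -/
theorem genuineFKitOfBadLocal_thToFBijOnGood : (D.genuineFKitOfBadLocal CG hS M hA hI B ΛBad ES I).ThToFBijOnGood :=
  fun _ _ => (Functor.FullyFaithful.id _).isoEquiv.bijective

/-- **Cor 5.3 (ii) `IsomFtoDBijective` HOLDS AS TYPED at the genuine kit** (for every `I`): `𝔉 ↦ 𝔇` is the fully faithful inclusion of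
the `𝒟_x`-isomorphs — the σ3 LABEL of the term («isomorphisms of collections of data READ AS isomorphisms of their bases»: a recorded
tautology, NOT evidence for print's Cor 5.3 (ii)). ([IUTchI] Cor 5.3 (ii) p.144) [claim: Mochizuki2012, status: disputed] -/
theorem genuineFKitOfBadLocal_isomFtoDBijective : (D.genuineFKitOfBadLocal CG hS M hA hI B ΛBad ES I).IsomFtoDBijective :=
  PMBaseKit.FKit.isomFtoDBijective_of_fullyFaithful fun _ => ObjectProperty.fullyFaithfulι _

/-- **Cor 5.3 (iv) `AutTemperedBijective` HOLDS AS TYPED at the genuine kit** (for every `I`): `ℱ̲_v ↦ ℱ_v ↦ 𝒟_v` is `𝟭 ⋙ ι`, fully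
faithful — same σ3 LABEL (tautology of the term, NOT evidence for print's Cor 5.3 (iv)). ([IUTchI] Cor 5.3 (iv) p.144) [claim: Mochizuki2012, status: disputed] -/
theorem genuineFKitOfBadLocal_autTemperedBijective : (D.genuineFKitOfBadLocal CG hS M hA hI B ΛBad ES I).AutTemperedBijective :=
  fun _ _ => ((Functor.FullyFaithful.id _).comp (ObjectProperty.fullyFaithfulι _)).isoEquiv.bijective

/-- **Functoriality `RlfOfNatural` of "`‡𝔉 ↦ ‡𝔉^⊩`" HOLDS at the genuine kit** (for every `I`): `rlfOfMap f = (𝟙, {f_v}_v)` is read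
componentwise by the second projection (the law that FAILED at `unitsLink D`, abc-iut-w5-d217's `not_rlfOfNatural_unitsLink`).
([IUTchI] Rmk 5.2.1 (ii) p.143) [claim: Mochizuki2012, status: disputed] -/
theorem genuineFKitOfBadLocal_rlfOfNatural : (D.genuineFKitOfBadLocal CG hS M hA hI B ΛBad ES I).RlfOfNatural := by
  intro F₁ F₂ f v
  show (f v).hom ≫ 𝟙 _ = 𝟙 _ ≫ (f v).hom
  rw [Category.comp_id, Category.id_comp]

/-- **Rmk 5.2.1 (ii) `RlfOfIsStrip` ("`‡𝔉 ↦ ‡𝔉^⊩` forms an `ℱ^⊩`-prime-strip") HOLDS at the genuine kit** (for every `I`):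
`(‡𝔉)^⊩ = (model, ‡𝔉) ≅ (model, 𝔉)`. ([IUTchI] Rmk 5.2.1 (ii) p.143) [claim: Mochizuki2012, status: disputed] -/
theorem genuineFKitOfBadLocal_rlfOfIsStrip : (D.genuineFKitOfBadLocal CG hS M hA hI B ΛBad ES I).RlfOfIsStrip := fun G =>
  letI := I.m4.cat
  ⟨Iso.prod (Iso.refl _) (Pi.isoMk fun v => (G.isModel v).some)⟩

/-- The `ℱ^⊢`-components of the kit's model `𝔉^⊩_mod` ARE the models `ℱ^⊢_x` (frames hypothesis of abc-iut-w5-d217's component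
criteria, by `Iso.refl`). ([IUTchI] Def 5.2 (iv) p.135) [claim: Mochizuki2012, status: disputed] -/
theorem genuineFKitOfBadLocal_rlfFm_rlfModel (v : D.IndexCopy) :
    Nonempty (((D.genuineFKitOfBadLocal CG hS M hA hI B ΛBad ES I).rlfFm v).obj
        (D.genuineFKitOfBadLocal CG hS M hA hI B ΛBad ES I).rlfModel ≅
      (D.genuineFKitOfBadLocal CG hS M hA hI B ΛBad ES I).fmModel v) :=
  ⟨Iso.refl _⟩

/-- **(ε) EVERY typed Θ-Hodge theater of the genuine kit is canonically framed** (for every `I`): `c := (†𝔉^⊩_mod.1 ≅ model, {rlf_fm,v}_v)`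
— the Def 3.6 (c) identification IS the algorithm's `rlfFm_rlfOf = Iso.refl` after `c`. ([IUTchI] Def 3.6 p.87) [claim: Mochizuki2012, status: disputed] -/
theorem genuineFKitOfBadLocal_isCanonical (H : (D.genuineFKitOfBadLocal CG hS M hA hI B ΛBad ES I).ThetaHT) : H.IsCanonical := by
  letI := I.m4.cat
  refine ⟨Iso.prod ((CategoryTheory.Prod.fst _ _).mapIso H.rlf_isModel.some) (Pi.isoMk fun v => H.rlf_fm v), fun v => ?_⟩
  show (H.rlf_fm v).hom ≫ 𝟙 _ = (H.rlf_fm v).hom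
  exact Category.comp_id _

/-- **Row L03b `RlfIsoLifts` HOLDS at the genuine kit** (for every `I`): a family of `ℱ^⊢`-isomorphisms `{d_v}_v` between isomorphs
`A`, `B` of `𝔉^⊩_mod` is induced by `(A.1 ≅ model ≅ B.1, {d_v}_v)` (abc-iut-w5-d217's `rlfIsoLifts_iff_component_surjective`).
([IUTchI] Cor 5.6 (i) p.154) [claim: Mochizuki2012, status: disputed] -/
theorem genuineFKitOfBadLocal_rlfIsoLifts : (D.genuineFKitOfBadLocal CG hS M hA hI B ΛBad ES I).RlfIsoLifts := by
  letI := I.m4.cat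
  rw [PMBaseKit.FKit.rlfIsoLifts_iff_component_surjective (D.genuineFKitOfBadLocal_rlfFm_rlfModel CG hS M hA hI B ΛBad ES I)]
  rintro A B ⟨eA⟩ ⟨eB⟩ d
  exact ⟨Iso.prod ((CategoryTheory.Prod.fst _ _).mapIso eA ≪≫ ((CategoryTheory.Prod.fst _ _).mapIso eB).symm) (Pi.isoMk d),
    funext fun v => Iso.ext rfl⟩

/-! ### §2 The one non-trivial conjunct: rigidity `RlfIsoFaithful` ⟺ the (m4) model has a single automorphism -/

/-- **Row L03a `RlfIsoFaithful` at the genuine kit ⟺ the model `I.m4.gModel` of the (m4) slot has exactly ONE automorphism in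
`I.m4.Glob`** ([IUTchI] Rmk 5.2.1 (ii) «the rigidity of the divisor monoids»: the `ℱ^⊢`-components of an isomorphism of `⊩`-data are
its second projection, so they determine it iff the `Glob`-part is forced — ⇒: test on `(a, 𝟙)` vs `(b, 𝟙)` at the model; ⇐:
conjugate into `Aut(model)`). ([IUTchI] Rmk 5.2.1 (ii) p.143) [claim: Mochizuki2012, status: disputed] -/
theorem genuineFKitOfBadLocal_rlfIsoFaithful_iff :
    (D.genuineFKitOfBadLocal CG hS M hA hI B ΛBad ES I).RlfIsoFaithful ↔
      (letI := I.m4.cat; Subsingleton (I.m4.gModel ≅ I.m4.gModel)) := by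
  letI := I.m4.cat
  rw [PMBaseKit.FKit.rlfIsoFaithful_iff_component_injective (D.genuineFKitOfBadLocal_rlfFm_rlfModel CG hS M hA hI B ΛBad ES I)]
  constructor
  · intro h
    refine ⟨fun a b => ?_⟩
    have hab := @h (D.genuineFKitOfBadLocal CG hS M hA hI B ΛBad ES I).rlfModel
      (D.genuineFKitOfBadLocal CG hS M hA hI B ΛBad ES I).rlfModel ⟨Iso.refl _⟩ ⟨Iso.refl _⟩
      (Iso.prod a (Iso.refl _)) (Iso.prod b (Iso.refl _)) (funext fun v => Iso.ext rfl)
    exact Iso.ext (congrArg (fun r => r.hom.1) hab)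
  · rintro h A B' ⟨eA⟩ ⟨eB⟩ r s hrs
    let e₁ : A.1 ≅ I.m4.gModel := (CategoryTheory.Prod.fst _ _).mapIso eA
    let e₂ : B'.1 ≅ I.m4.gModel := (CategoryTheory.Prod.fst _ _).mapIso eB
    have hconj : ∀ φ : A.1 ≅ B'.1, e₁ ≪≫ (e₁.symm ≪≫ φ ≪≫ e₂) ≪≫ e₂.symm = φ := fun φ => by ext; simp
    have h₁ : (CategoryTheory.Prod.fst _ _).mapIso r = (CategoryTheory.Prod.fst _ _).mapIso s := by
      have key := congrArg (fun φ => e₁ ≪≫ φ ≪≫ e₂.symm)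
        (@Subsingleton.elim _ h (e₁.symm ≪≫ (CategoryTheory.Prod.fst _ _).mapIso r ≪≫ e₂)
          (e₁.symm ≪≫ (CategoryTheory.Prod.fst _ _).mapIso s ≪≫ e₂))
      exact ((hconj _).symm.trans key).trans (hconj _)
    refine Iso.ext (CategoryTheory.Prod.hom_ext (congrArg Iso.hom h₁) (funext fun v => ?_))
    exact congrArg Iso.hom (congrFun hrs v)

/-- **Row L03 `RlfDetermined` at the genuine kit ⟺ the same rigidity of the (m4) model** (L03b holds, `…_rlfIsoLifts`).
([IUTchI] Cor 5.6 (i) p.154) [claim: Mochizuki2012, status: disputed] -/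
theorem genuineFKitOfBadLocal_rlfDetermined_iff :
    (D.genuineFKitOfBadLocal CG hS M hA hI B ΛBad ES I).RlfDetermined ↔
      (letI := I.m4.cat; Subsingleton (I.m4.gModel ≅ I.m4.gModel)) := by
  rw [PMBaseKit.FKit.rlfDetermined_iff_faithful_and_lifts, D.genuineFKitOfBadLocal_rlfIsoFaithful_iff CG hS M hA hI B ΛBad ES I]
  exact ⟨fun h => h.1, fun h => ⟨h, D.genuineFKitOfBadLocal_rlfIsoLifts CG hS M hA hI B ΛBad ES I⟩⟩

/-- **[IUTchI] Cor 5.6 (i) over the genuine kit, ALL typed framings (`Cor56iKit`) ⟺ the (m4) model has a single automorphism**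
(abc-iut-w5-d217's exact cut `cor56iKit_iff_rlfDetermined` with L02, Cor 5.3 (ii), (iv) discharged above).
([IUTchI] Cor 5.6 (i) p.153) [claim: Mochizuki2012, status: disputed] -/
theorem genuineFKitOfBadLocal_cor56iKit_iff :
    (D.genuineFKitOfBadLocal CG hS M hA hI B ΛBad ES I).Cor56iKit ↔
      (letI := I.m4.cat; Subsingleton (I.m4.gModel ≅ I.m4.gModel)) :=
  (PMBaseKit.FKit.cor56iKit_iff_rlfDetermined (D.genuineFKitOfBadLocal_thToFBijOnGood CG hS M hA hI B ΛBad ES I)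
      (D.genuineFKitOfBadLocal_isomFtoDBijective CG hS M hA hI B ΛBad ES I)
      (D.genuineFKitOfBadLocal_autTemperedBijective CG hS M hA hI B ΛBad ES I)).trans
    (D.genuineFKitOfBadLocal_rlfDetermined_iff CG hS M hA hI B ΛBad ES I)

/-- **[IUTchI] Cor 5.6 (i) for canonically framed theaters (`Cor56iKitCanonical`, ruling (b)) at the genuine kit ⟺ the SAME
rigidity** — every typed theater being canonical here (`…_isCanonical`), the print-faithful form and the all-framings form coincide.
([IUTchI] Cor 5.6 (i) p.153) [claim: Mochizuki2012, status: disputed] -/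
theorem genuineFKitOfBadLocal_cor56iKitCanonical_iff :
    (D.genuineFKitOfBadLocal CG hS M hA hI B ΛBad ES I).Cor56iKitCanonical ↔
      (letI := I.m4.cat; Subsingleton (I.m4.gModel ≅ I.m4.gModel)) :=
  ⟨fun h => (D.genuineFKitOfBadLocal_cor56iKit_iff CG hS M hA hI B ΛBad ES I).1 fun H₁ H₂ =>
      h H₁ H₂ (D.genuineFKitOfBadLocal_isCanonical CG hS M hA hI B ΛBad ES I H₁)
        (D.genuineFKitOfBadLocal_isCanonical CG hS M hA hI B ΛBad ES I H₂),
    fun h => PMBaseKit.FKit.cor56iKitCanonical_of_cor56iKit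
      ((D.genuineFKitOfBadLocal_cor56iKit_iff CG hS M hA hI B ΛBad ES I).2 h)⟩

/-! ### §3 Instances: the slot of record (over `F_{Φ^rlf}`) HOLDS; the bare slot is REFUTED-AT-KIT -/

section OverPhi

variable (L : Type) [Field L] [NumberField L]

/-- **At the (m4) slot OVER `F_{Φ^rlf}` the rigidity row `RlfIsoFaithful` HOLDS at the genuine kit.** ([IUTchI] Rmk 5.2.1 (ii) p.143) [claim: Mochizuki2012, status: disputed] -/
theorem genuineFKitOfBadLocal_rlfIsoFaithful_withM4_overPhi :
    (D.genuineFKitOfBadLocal CG hS M hA hI B ΛBad ES (I.withM4 (RealifiedGlobalSide.ofNumberFieldOverPhi L))).RlfIsoFaithful :=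
  (D.genuineFKitOfBadLocal_rlfIsoFaithful_iff CG hS M hA hI B ΛBad ES _).2 (subsingleton_iso_gModel_ofNumberFieldOverPhi L)

/-- **At the (m4) slot OVER `F_{Φ^rlf}`, [IUTchI] Cor 5.6 (i) HOLDS AT THE GENUINE KIT for ALL typed framings (`Cor56iKit`).**
([IUTchI] Cor 5.6 (i) p.153) [claim: Mochizuki2012, status: disputed] -/
theorem genuineFKitOfBadLocal_cor56iKit_withM4_overPhi :
    (D.genuineFKitOfBadLocal CG hS M hA hI B ΛBad ES (I.withM4 (RealifiedGlobalSide.ofNumberFieldOverPhi L))).Cor56iKit :=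
  (D.genuineFKitOfBadLocal_cor56iKit_iff CG hS M hA hI B ΛBad ES _).2 (subsingleton_iso_gModel_ofNumberFieldOverPhi L)

/-- … hence for canonically framed theaters (`Cor56iKitCanonical`). ([IUTchI] Cor 5.6 (i) p.153) [claim: Mochizuki2012, status: disputed] -/
theorem genuineFKitOfBadLocal_cor56iKitCanonical_withM4_overPhi :
    (D.genuineFKitOfBadLocal CG hS M hA hI B ΛBad ES (I.withM4 (RealifiedGlobalSide.ofNumberFieldOverPhi L))).Cor56iKitCanonical :=
  (D.genuineFKitOfBadLocal_cor56iKitCanonical_iff CG hS M hA hI B ΛBad ES _).2 (subsingleton_iso_gModel_ofNumberFieldOverPhi L)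

/-- **THE SLOT OF RECORD `I.overPhi` (`𝒞⊩_mod` of `F_mod` over `F_{Φ^rlf}`): `Cor56iKit` HOLDS at the genuine kit.**
([IUTchI] Cor 5.6 (i) p.153) [claim: Mochizuki2012, status: disputed] -/
theorem genuineFKitOfBadLocal_cor56iKit_overPhi :
    (D.genuineFKitOfBadLocal CG hS M hA hI B ΛBad ES I.overPhi).Cor56iKit :=
  D.genuineFKitOfBadLocal_cor56iKit_withM4_overPhi CG hS M hA hI B ΛBad ES I _

/-- … `Cor56iKitCanonical` HOLDS at the genuine kit with `I.overPhi`. ([IUTchI] Cor 5.6 (i) p.153) [claim: Mochizuki2012, status: disputed] -/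
theorem genuineFKitOfBadLocal_cor56iKitCanonical_overPhi :
    (D.genuineFKitOfBadLocal CG hS M hA hI B ΛBad ES I.overPhi).Cor56iKitCanonical :=
  D.genuineFKitOfBadLocal_cor56iKitCanonical_withM4_overPhi CG hS M hA hI B ΛBad ES I _

/-- … `RlfIsoFaithful` and `RlfDetermined` HOLD at the genuine kit with `I.overPhi`. ([IUTchI] Rmk 5.2.1 (ii) p.143) [claim: Mochizuki2012, status: disputed] -/
theorem genuineFKitOfBadLocal_rlfDetermined_overPhi :
    (D.genuineFKitOfBadLocal CG hS M hA hI B ΛBad ES I.overPhi).RlfIsoFaithful ∧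
      (D.genuineFKitOfBadLocal CG hS M hA hI B ΛBad ES I.overPhi).RlfDetermined :=
  ⟨D.genuineFKitOfBadLocal_rlfIsoFaithful_withM4_overPhi CG hS M hA hI B ΛBad ES I _,
    (D.genuineFKitOfBadLocal_rlfDetermined_iff CG hS M hA hI B ΛBad ES _).2 (subsingleton_iso_gModel_ofNumberFieldOverPhi _)⟩

/-- **At the BARE (m4) slot `RealifiedGlobalSide.ofNumberField L` the rigidity row `RlfIsoFaithful` is REFUTED AT THE KIT** (witness:
the global components `([powFunctor 2], 𝟙)` and `(1, 𝟙)` of two automorphisms of the model theater have the same `ℱ^⊢`-components).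
([IUTchI] Rmk 5.2.1 (ii) p.143) [claim: Mochizuki2012, status: disputed] -/
theorem genuineFKitOfBadLocal_not_rlfIsoFaithful_withM4_ofNumberField :
    ¬ (D.genuineFKitOfBadLocal CG hS M hA hI B ΛBad ES (I.withM4 (RealifiedGlobalSide.ofNumberField L))).RlfIsoFaithful :=
  fun h => not_subsingleton_iso_gModel_ofNumberField L
    ((D.genuineFKitOfBadLocal_rlfIsoFaithful_iff CG hS M hA hI B ΛBad ES _).1 h)

/-- **At the BARE (m4) slot, [IUTchI] Cor 5.6 (i) AS TYPED (`Cor56iKit`, all framings) is REFUTED AT THE KIT.**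
([IUTchI] Cor 5.6 (i) p.153) [claim: Mochizuki2012, status: disputed] -/
theorem genuineFKitOfBadLocal_not_cor56iKit_withM4_ofNumberField :
    ¬ (D.genuineFKitOfBadLocal CG hS M hA hI B ΛBad ES (I.withM4 (RealifiedGlobalSide.ofNumberField L))).Cor56iKit :=
  fun h => not_subsingleton_iso_gModel_ofNumberField L
    ((D.genuineFKitOfBadLocal_cor56iKit_iff CG hS M hA hI B ΛBad ES _).1 h)

/-- **At the BARE (m4) slot even the canonically-framed form `Cor56iKitCanonical` is REFUTED AT THE KIT** (all theaters are canonical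
here, so (b)'s restriction does not rescue the bare slot: rigidity is the load-bearing law, as in abc-iut-w5-d217's
`exists_fkit_canonical_laws_not_faithful`). ([IUTchI] Cor 5.6 (i) p.153) [claim: Mochizuki2012, status: disputed] -/
theorem genuineFKitOfBadLocal_not_cor56iKitCanonical_withM4_ofNumberField :
    ¬ (D.genuineFKitOfBadLocal CG hS M hA hI B ΛBad ES (I.withM4 (RealifiedGlobalSide.ofNumberField L))).Cor56iKitCanonical :=
  fun h => not_subsingleton_iso_gModel_ofNumberField L
    ((D.genuineFKitOfBadLocal_cor56iKitCanonical_iff CG hS M hA hI B ΛBad ES _).1 h)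

/-- **At abc-iut-L5-t2's bare (m4) inhabitant `realifiedGlobalSideOfModuli` (★ p497530, `𝒞⊩_mod` of `F_mod` in its one-object kind)
`Cor56iKit` and `Cor56iKitCanonical` are REFUTED AT THE KIT** — RULINGS #120 (1)(a) «refuted-at-bare-m4» as a theorem.
([IUTchI] Cor 5.6 (i) p.153) [claim: Mochizuki2012, status: disputed] -/
theorem genuineFKitOfBadLocal_not_cor56iKit_withM4_ofModuli :
    ¬ (D.genuineFKitOfBadLocal CG hS M hA hI B ΛBad ES (I.withM4 D.realifiedGlobalSideOfModuli)).Cor56iKit ∧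
      ¬ (D.genuineFKitOfBadLocal CG hS M hA hI B ΛBad ES (I.withM4 D.realifiedGlobalSideOfModuli)).Cor56iKitCanonical :=
  ⟨D.genuineFKitOfBadLocal_not_cor56iKit_withM4_ofNumberField CG hS M hA hI B ΛBad ES I _,
    D.genuineFKitOfBadLocal_not_cor56iKitCanonical_withM4_ofNumberField CG hS M hA hI B ΛBad ES I _⟩

end OverPhi

/-! ### §4 Summary schema: the five inputs of `cor56iKitCanonical_of_laws` at the genuine kit -/

/-- **The (b)-closer `cor56iKitCanonical_of_laws` instantiated at the genuine kit**: its inputs L02, Cor 5.3 (ii), Cor 5.3 (iv) and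
functoriality are THEOREMS here, so `Cor56iKitCanonical` at the genuine kit follows from the rigidity row ALONE — and conversely
(`…_cor56iKitCanonical_iff`): at this term [IUTchI] Cor 5.6 (i) in either typed form IS the statement «`Aut(I.m4.gModel)` is trivial».
([IUTchI] Cor 5.6 (i) p.153) [claim: Mochizuki2012, status: disputed] -/
theorem genuineFKitOfBadLocal_cor56iKitCanonical_of_rlfIsoFaithful
    (hfaith : (D.genuineFKitOfBadLocal CG hS M hA hI B ΛBad ES I).RlfIsoFaithful) :
    (D.genuineFKitOfBadLocal CG hS M hA hI B ΛBad ES I).Cor56iKitCanonical :=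
  PMBaseKit.FKit.cor56iKitCanonical_of_laws (D.genuineFKitOfBadLocal_thToFBijOnGood CG hS M hA hI B ΛBad ES I)
    (D.genuineFKitOfBadLocal_isomFtoDBijective CG hS M hA hI B ΛBad ES I)
    (D.genuineFKitOfBadLocal_autTemperedBijective CG hS M hA hI B ΛBad ES I) hfaith
    (D.genuineFKitOfBadLocal_rlfOfNatural CG hS M hA hI B ΛBad ES I)

end InitialThetaData

end Literature.IUT.HodgeTheaters

end
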